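import Summits.AtomisticToContinuum.HydrodynamicLimit.Theorems.LambertianContactSwapContactAngleEquidistributionNearFieldTools
import HarnessLib

/-!
# Bookkeeping for the equilibrium crux (stub `stub_eqCruxParts`, line `Sketch` v5, crux
# `LambertianContactSwap.ContactAngleEquidistribution`, stmt-AtomisticToContinuum-12097; lead c2)

Generic tools consumed by the assembly `stub_eqCrux` (file `…EqCrux`): the passage from a bound on the
difference of the lower integrals of the positive / negative parts of a real mark to a bound on its Bochner
integral (`stub_eqCruxParts`), the real-valued form of an `ℝ≥0∞` sandwich (`abs_toReal_sub_le`), pair-count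
bookkeeping (`sum_ite_lt_mul`, `sum_ite_lt_le`), `ofReal` through a selector, the domination of a signed part
of the centred `|g|²`-weighted mark by the weight `1 + |g|³`, and the measurability of that signed part in
(midpoint, incoming velocities, normal). No mathematics beyond measure-theoretic bookkeeping.
-/

noncomputable section

open MeasureTheory Filter Set Topology ProbabilityTheory
open scoped ENNReal BigOperators Classical RealInnerProductSpace

namespace Summit.AtomisticToContinuum.HydrodynamicLimit.Theorems.ContactAngleEquidistributionSketch

open Literature.Analysis.FluidPDE Literature.MathematicalPhysics.KineticTheory

namespace EqCrux

/-! ### Generic bookkeeping -/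

/-- **Registered sub-goal `stub_eqCruxParts`** (line `Sketch` v5, crux ContactAngleEquidistribution,
stmt-AtomisticToContinuum-12097): `|∫ f| ≤ C` BY POSITIVE / NEGATIVE PARTS — as
`EqCentring.integral_eq_zero_of_parts`, with the equality of the two lower integrals replaced by a bound on
the difference of their real values. [folklore] -/
theorem stub_eqCruxParts {α : Type*} [MeasurableSpace α] {μ : Measure α}
    {f g₁ g₂ W : α → ℝ} (hW : ∫⁻ z, ENNReal.ofReal (W z) ∂μ ≠ ⊤) (h₁m : Measurable g₁)
    (h₂m : Measurable g₂) (hWm : Measurable W) (c : ℝ) (hW0 : ∀ z, 0 ≤ W z)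
    (h₁W : ∀ z, |g₁ z| ≤ c * W z) (h₂W : ∀ z, |g₂ z| ≤ c * W z) (h₁0 : ∀ z, 0 ≤ g₁ z)
    (h₂0 : ∀ z, 0 ≤ g₂ z) (hf : ∀ z, f z = g₁ z - g₂ z) {C : ℝ}
    (h : |(∫⁻ z, ENNReal.ofReal (g₁ z) ∂μ).toReal - (∫⁻ z, ENNReal.ofReal (g₂ z) ∂μ).toReal| ≤ C) :
    |∫ z, f z ∂μ| ≤ C := by
  have hWi : Integrable W μ :=
    ⟨hWm.aestronglyMeasurable, (hasFiniteIntegral_iff_ofReal (ae_of_all _ hW0)).2 hW.lt_top⟩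
  have hint : ∀ {g : α → ℝ}, Measurable g → (∀ z, |g z| ≤ c * W z) → Integrable g μ :=
    fun hgm hgW => (hWi.const_mul c).mono' hgm.aestronglyMeasurable
      (ae_of_all _ fun z => by rw [Real.norm_eq_abs]; exact hgW z)
  have e : ∫ z, f z ∂μ = (∫⁻ z, ENNReal.ofReal (g₁ z) ∂μ).toReal - (∫⁻ z, ENNReal.ofReal (g₂ z) ∂μ).toReal := by
    rw [integral_congr_ae (ae_of_all μ hf), integral_sub (hint h₁m h₁W) (hint h₂m h₂W),
      integral_eq_lintegral_of_nonneg_ae (ae_of_all _ h₁0) h₁m.aestronglyMeasurable,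
      integral_eq_lintegral_of_nonneg_ae (ae_of_all _ h₂0) h₂m.aestronglyMeasurable]
  rw [e]
  exact h

/-- **A sandwich in `ℝ≥0∞` bounds the difference of real values.** [folklore] -/
theorem abs_toReal_sub_le {a b C : ℝ≥0∞} (hab : a ≤ b + C) (hba : b ≤ a + C) (ha : a ≠ ⊤)
    (hb : b ≠ ⊤) (hC : C ≠ ⊤) : |a.toReal - b.toReal| ≤ C.toReal := by
  rw [abs_sub_le_iff]
  constructor
  · have h := ENNReal.toReal_mono (ENNReal.add_ne_top.2 ⟨hb, hC⟩) hab
    rw [ENNReal.toReal_add hb hC] at h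
    linarith
  · have h := ENNReal.toReal_mono (ENNReal.add_ne_top.2 ⟨ha, hC⟩) hba
    rw [ENNReal.toReal_add ha hC] at h
    linarith

/-- Pair-count bookkeeping: a sum of a constant over `i < j` is the pair count times the constant. [folklore] -/
theorem sum_ite_lt_mul (n : ℕ) (X : ℝ≥0∞) :
    ∑ i : Fin n, ∑ j : Fin n, (if i < j then X else 0) =
      (∑ i : Fin n, ∑ j : Fin n, if i < j then (1 : ℝ≥0∞) else 0) * X := by
  rw [Finset.sum_mul]
  refine Finset.sum_congr rfl fun i _ => ?_
  rw [Finset.sum_mul]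
  refine Finset.sum_congr rfl fun j _ => ?_
  split_ifs <;> simp

/-- The pair count is at most `n²`. [folklore] -/
theorem sum_ite_lt_le (n : ℕ) :
    (∑ i : Fin n, ∑ j : Fin n, if i < j then (1 : ℝ≥0∞) else 0) ≤ (n : ℝ≥0∞) * n := by
  calc (∑ i : Fin n, ∑ j : Fin n, if i < j then (1 : ℝ≥0∞) else 0)
      ≤ ∑ _i : Fin n, ∑ _j : Fin n, (1 : ℝ≥0∞) :=
        Finset.sum_le_sum fun i _ => Finset.sum_le_sum fun j _ => by split_ifs <;> simp
    _ = (n : ℝ≥0∞) * n := by simp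

/-- `ofReal` through a selected positive part (instance-polymorphic). [folklore] -/
theorem ofReal_ite {p : Prop} {ip ip' : Decidable p} (a : ℝ) :
    ENNReal.ofReal (@ite _ p ip a 0) = @ite _ p ip' (ENNReal.ofReal a) 0 := by
  by_cases hp : p
  · simp only [if_pos hp]
  · simp only [if_neg hp, ENNReal.ofReal_zero]

/-- The selected signed part of a mark dominated by `2x²` is dominated by twice the selected weight
`1 + x³` (`x² ≤ 1 + x³`). [folklore] -/
theorem abs_ite_part_le {p : Prop} {ip ip' : Decidable p} {a c x : ℝ} (hc : |c| = 1) (hx : 0 ≤ x)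
    (ha : |a| ≤ 2 * x ^ 2) : |@ite _ p ip (max (c * a) 0) 0| ≤ 2 * @ite _ p ip' (1 + x ^ 3) 0 := by
  by_cases hp : p
  · simp only [if_pos hp]
    rw [abs_of_nonneg (le_max_right _ _)]
    refine max_le ?_ (by positivity)
    calc c * a ≤ |c * a| := le_abs_self _
      _ = |a| := by rw [abs_mul, hc, one_mul]
      _ ≤ 2 * x ^ 2 := ha
      _ ≤ 2 * (1 + x ^ 3) := by
          have : x ^ 2 ≤ 1 + x ^ 3 := by
            rcases le_or_gt x 1 with h | h
            · nlinarith [mul_le_one₀ h hx h, pow_nonneg hx 3]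
            · nlinarith [mul_nonneg (sq_nonneg x) (sub_nonneg.2 h.le)]
          linarith
  · simp only [if_neg hp, abs_zero, mul_zero, le_refl]

/-- Measurability of the signed part of the centred mark as a function of (midpoint, `v`, `w`, normal)
with the normal in `V3`. [folklore] -/
theorem measurable_markPartV {ψ : ℝ → T3 → V3 → V3 → V3 → ℝ}
    (hψ : Measurable fun p : ℝ × T3 × V3 × V3 × V3 => ψ p.1 p.2.1 p.2.2.1 p.2.2.2.1 p.2.2.2.2)
    (s c : ℝ) :
    Measurable fun p : T3 × V3 × V3 × V3 =>
      ENNReal.ofReal (max (c * (‖p.2.1 - p.2.2.1‖ ^ 2 *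
        (ψ s p.1 p.2.1 p.2.2.1 p.2.2.2 -
          ∫ ξ, ψ s p.1 p.2.1 p.2.2.1
            (‖‖-(p.2.1 - p.2.2.1)‖⁻¹ • (-(p.2.1 - p.2.2.1)) + ‖ξ‖⁻¹ • ξ‖⁻¹ •
              (‖-(p.2.1 - p.2.2.1)‖⁻¹ • (-(p.2.1 - p.2.2.1)) + ‖ξ‖⁻¹ • ξ)) ∂(stdGaussian V3)))) 0) := by
  have hv : Measurable fun p : T3 × V3 × V3 × V3 => p.2.1 := measurable_fst.comp measurable_snd
  have hw : Measurable fun p : T3 × V3 × V3 × V3 => p.2.2.1 :=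
    measurable_fst.comp (measurable_snd.comp measurable_snd)
  have hn : Measurable fun p : T3 × V3 × V3 × V3 => p.2.2.2 :=
    measurable_snd.comp (measurable_snd.comp measurable_snd)
  have h1 := NearField.measurable_psiAt hψ (measurable_const (a := s)) measurable_fst hv hw hn
  have h2 := NearField.measurable_cosineMean hψ (measurable_const (a := s)) measurable_fst hv hw (hv.sub hw)
  exact ((measurable_const.mul (((hv.sub hw).norm.pow_const 2).mul (h1.sub h2))).max
    measurable_const).ennreal_ofReal

end EqCrux

end Summit.AtomisticToContinuum.HydrodynamicLimit.Theorems.ContactAngleEquidistributionSketch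

end
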